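import Mathlib
import HarnessLib
import Literature.MathematicalPhysics.QuantumFieldTheory.Balaban1983to89.B10StarCount

/-!
# `Balaban1983to89.B10Eq22Rescaling` — [Balaban1985UV3] p. 261: **(21)** and *"Finally we make the transformation
# A → g₀A in (18). Taking into account this transformation and the formulas (19)–(21), we obtain (22)"* — the
# bookkeeping of that sentence (Jacobian `exp[d(𝔤)log g₀|Ω₁*|]`, the `σ₀`-count `exp[log σ₀|Ω₁*|]`, the exponent of
# the first member of (22), the rescaled cut-off `χ`), PROVED

T. Bałaban, *Ultraviolet stability of three-dimensional lattice pure gauge field theories*, Commun. Math. Phys. **102**,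
255–275 (1985) [Balaban1985UV3] (cell paper B10; held `paper:balaban1985-cmp102-uv-stability-3d`; journal page =
PDF page + 254).  The quotations below were READ AS IMAGES on the renders
`run/shared/lean/pub/pub-balaban/b2b-balaban-ref1/pages/1985-cmp102-uv-stability-3d/…-p005-x2.png` (p. 259),
`…-p006-x2.png` (p. 260), `…-p007-x2.png` (p. 261), `…-p017-x2.png` (p. 271), 2026-08-21.

HONEST FRAMING (mega-formalization `lit-balaban`, verbatim): statement-level skeleton of published theorems with
citation tags; proofs where landed; nothing here is a claim about the Yang–Mills mass gap.

WHAT IS PRINTED (verbatim).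
* p. 259, (16): *"The δ-function in (13) can be written as Π_{c∈Ω₁^{(1)}} δ((U′U₁)‾(c)(Ū₁(c))⁻¹) = Π_{c∈Ω₁^{(1)}} (1/σ₀)
  δ(Q(A′, c)), (16) where the δ-functions on the right are defined on the vector space 𝔤, and concentrated at the
  origin of this space. The constant σ₀ will be discussed later."*
* p. 260: *"To write the integrals (13) in terms of the variables A′ we express the Haar measure dU′ as dU′ = σ(A′)dA′
  = σ₀ σ/σ₀ (A′)dA′, σ₀ = σ(0), where dA′ is the Lebesque measure on 𝔤, and σ(A′) is a density which can be
  calculated explicitly for all classical groups. … Generally σ(A) is an analytic, positive, even function of A in a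
  neighbourhood of 0∈𝔤 …"*; (18): *"× ∫dA↾_{Ω₁} det(I − (δ/δA)D̃(A)) (σ/σ₀)(A − D̃(A)) δ(QA)δ_{Ax}(A) χ ×
  exp[−(1/g₀²)A(exp i(A − D̃(A))U₁) − E + log σ₀|Ω₁*|], (18) where χ = Π_{b∈Ω₁} χ({|A(b)| < g₀p²(g₀)}), g₀
  sufficiently small, and |Ω₁*| denotes the number of bonds belonging to Ω₁ minus the number of bonds in Ω₁^{(1)} and
  minus the number of bonds in the axial gauge fixing set."*
* p. 261, (19): *"A(exp i(A − D̃(A))U₁) = A(U₁) − ⟨D̃(A), J⟩ + ½⟨A − D̃(A), Δ(U₁)(A − D̃(A))⟩ + V₀(A − D̃(A))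
  = A(U₁) − ⟨D̃^{(2)}(A), J⟩ + ½⟨A, Δ(U₁)A⟩ + Ṽ₀(A), (19) where Ṽ₀(A) is defined by the last equality."*;
  p. 260: *"Denoting the terms by D̃^{(2)}(A), we have … D̃^{(2)}(A, b₀(c), c) can be expressed as a linear operator on 𝔤
  acting on C^{(2)}(A, c)"* — `D̃^{(2)}` is the second-order (homogeneous of degree two) part of `D̃`.
* p. 261, (21): *"Similarly for the function σ/σ₀, (σ/σ₀)(A − D̃(A)) = exp[Σ_{b∈Ω₁} (log σ/σ₀)(A(b) − D̃(A, c(b), b))].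
  (21) Let us denote the terms in the exponentials in (20), (21) by 𝓋(A). Finally we make the transformation A → g₀A
  in (18). Taking into account this transformation and the formulas (19)–(21), we obtain"* (22), whose first member is
  *"Σ_{Ω₁} χ₁ ∫dV₀↾ Π δ(V̄₀(b′)V⁻¹(b′)) ζ × ∫dA↾_{Ω₁} δ(QA)δ_{Ax}(A) χ exp[𝓋(g₀A) − (1/g₀²)A(U₁) + ⟨D̃^{(2)}(A), J⟩ −
  ½⟨A, Δ(U₁)A⟩ − (1/g₀²)Ṽ₀(g₀A) − E + log σ₀|Ω₁*| + d(𝔤)log g₀|Ω₁*|]"*, *"where χ = Π_{b∈Ω₁} χ({|A(b)| < p²(g₀)}),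
  and d(𝔤) denotes a dimension of the Lie algebra 𝔤."*
* p. 271: *"We eliminate the δ-functions and we write the integral in terms of the independent variables Ã
  introduced at the beginning of Sect. E [5]. They are connected with A by the simple linear operator C described
  there, A = CÃ"* — the constrained integral `∫dA↾_{Ω₁} δ(QA)δ_{Ax}(A) …` is an integral against Lebesgue measure on
  a linear space of independent variables.

WHY THIS FILE EXISTS (unit `lit-balaban-r07`, reader/typer and fold owner of B10, gen 8).  SKELETON rows B10.Eq21 (the
display (21)) and B10.Eq22 (leaf `B10SectAGathering.Bound55`, whose exponent carries `(logσ₀ + dg·log g_k)·starB h`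
as DATA).  The sentence *"Taking into account this transformation and the formulas (19)–(21), we obtain (22)"* is pure
finite-dimensional bookkeeping once the constrained integral is read, as p. 271 says, as an integral over a linear
space `S` of independent variables: (i) the Jacobian of `A′ = g₀A` on `S` is `g₀^{dim S}`, (ii) `dim S = d(𝔤)·|Ω₁*|`
when the `d(𝔤)`-valued δ-constraints (one per coarse bond of Ω₁^{(1)} and one per axial-gauge condition) are
independent — rank–nullity —, (iii) the powers of `σ₀` from `dU′ = σ₀(σ/σ₀)dA′` per bond and `1/σ₀` per δ ((16), (9))
collect to `σ₀^{|Ω₁*|}`, (iv) (21) turns the product of `σ/σ₀` into `exp Σ log`, (v) in the exponent, `−(1/g₀²)` times the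
second line of (19) at `g₀A` gives `−(1/g₀²)A(U₁) + ⟨D̃^{(2)}(A), J⟩ − ½⟨A, Δ(U₁)A⟩ − (1/g₀²)Ṽ₀(g₀A)` because
`D̃^{(2)}` is homogeneous of degree two and `⟨·, Δ(U₁)·⟩` is bilinear, and (vi) `χ({|g₀A(b)| < g₀p²(g₀)}) =
χ({|A(b)| < p²(g₀)})`.  Each of (i)–(vi) is proved below over abstract finite-dimensional data, and (i)–(vi) are
assembled into the first member of (22).  The SECOND member of (22) (the Gaussian normalisation `Z^{(0)}(Ω₁, U₁)`,
`dμ_{C^{(0)}}`, `Ṽ`) is a DEFINITION the print leaves implicit (cell GAPS G-B10-03) and is not touched; the count `|Ω₁*|`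
itself is the sibling `…B10StarCount` (same seat; imported for §6).

WHAT THIS FILE PROVES (kernel, no `sorry`, axioms standard; no definition of `Prop` type, NO new named fact).
§1 `eq21` — **(21)** as the identity `Π_b ρ_b = exp Σ_b log ρ_b` for positive factors (`ρ_b = (σ/σ₀)(A(b) − D̃(A, c(b), b))`,
   positive near `0 ∈ 𝔤` by p. 260), and `haar_density_split` (`Π_b σ(A′_b) = σ₀^{n}·Π_b (σ/σ₀)(A′_b)`),
   `sigma0_pow_bookkeeping` (`σ₀^{#bonds}·σ₀^{−#coarse}·σ₀^{−#axial} = exp[log σ₀·|Ω₁*|]`).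
§2 `integral_rescale` — **the transformation `A → g₀A`**: on a finite-dimensional real space `S` with an additive Haar
   (Lebesgue) measure, `∫ W(A′)dA′ = exp[dim S · log g₀] ∫ W(g₀A)dA` (`g₀ > 0`; Mathlib `Measure.integral_comp_smul`).
§3 `finrank_ker_constraints` — **`dim S = d(𝔤)|Ω₁*|`**: for a SURJECTIVE `ℝ`-linear constraint map
   `C : (bonds → 𝔤) → (constraints → 𝔤)`, `dim ker C = d(𝔤)·(#bonds − #constraints)` (rank–nullity); with
   `#constraints = #coarse bonds + #axial conditions` this is `d(𝔤)|Ω₁*|` (`finrank_ker_eq_dg_mul_star`).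
§4 `exponent_rescale` — (v); `cutoff_rescale` — (vi).
§5 `eq22_first_member` — (i)+(iv)+(v)+(vi) assembled: the `A′`-integral of (18) (with (19)–(21) inserted) equals
   `exp[−E + log σ₀|Ω₁*| + dim S·log g₀]` times the `A`-integral of the first member of (22); and
   `eq22_first_member_constants`: with `dim S = d(𝔤)|Ω₁*|` the constant is **`exp[−E + log σ₀|Ω₁*| + d(𝔤)log g₀|Ω₁*|]`**.
§6 on the lattice carrier of record (`…Setup`, `…B10StarCount`): `axialPairs`/`card_axialPairs` (the index set of (9)),
   `finrank_ker_eq_dg_mul_starCount` (**`dim ker C = d(𝔤)·starCount Λ`** for independent constraints indexed by the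
   coarse bonds of `Λ` and the axial pairs, on the `𝔤`-valued fields over the bonds of `B(Λ)`), and
   `eq22_first_member_lattice` (the constant `exp[−E + log σ₀|B(Λ)*| + d(𝔤)log g₀|B(Λ)*|]` with `|B(Λ)*| = starCount Λ`).
§7 the printed example `G = SU(2)` (p. 260: `σ(A) = (1/2π²)(sin|A|/|A|)²`): `sigmaSU2`, `sigmaSU2_zero` (`σ₀ = 1/(2π²)`),
   `sigmaSU2_pos` / `sigmaSU2_ratio_pos` (positivity on `|A| < π`, the hypothesis of `eq21`); the formula is transcribed,
   not derived from the Haar measure.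
§8 (v1.1, r07 gen 17, APPEND-ONLY) the printed NORMALISATION `σ₀ = 1/2π²`: **`integral_sigmaSU2_ball`** —
   `∫_{|A|<π} σ_{SU(2)}(|A|) d³A = 1` on `ℝ³ = EuclideanSpace ℝ (Fin 3)` (radial integration, Mathlib
   `integral_fun_norm_addHaar`; `4π · (1/2π²) · ∫₀^π sin² = 1`): with the printed `σ₀` the density is a probability density
   on the injectivity ball `|A| < π` of the exponential chart `A ↦ e^{iA}` of `SU(2)` — consistent with the normalised Haar
   measure `∫dU′ = 1`; the companion files `B10Eq18SigmaSU2` (r07 g17: `σ(A)/σ₀ = (sin|A|/|A|)²` DERIVED in the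
   `B13HaarSigma` dictionary) and `B13HaarSigma` supply the shape, this § only the constant. (That the chart is injective
   on `|A| < π` and covers `SU(2)` up to a null set is NOT formalised here.)

SCOPE, stated honestly.  The δ-functions are not formalised as distributions: following p. 271 the constrained
integral is an integral over the linear space `S` of independent variables (any finite-dimensional real normed space
with an additive Haar measure; the identification `S = ker C` and the surjectivity of `C` — independence of the
printed δ-constraints — are hypotheses, discharged nowhere in print either).  `σ`, `D̃`, `D̃^{(2)}`, `Ṽ₀`, `J`, `Δ(U₁)`,
`𝓋` enter as abstract data with exactly the properties the sentence uses (positivity of `σ/σ₀` on the arguments;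
degree-two homogeneity of `A ↦ ⟨D̃^{(2)}(A), J⟩`; bilinearity of `⟨·, Δ(U₁)·⟩`); nothing of the series is constructed.
Value = the printed one-sentence derivation of (22)'s first member from (18)–(21), kernel-checked; NOT summit progress.
-/

noncomputable section

namespace Literature.MathematicalPhysics.QuantumFieldTheory.Balaban1983to89.B10Eq22Rescaling

open _root_.MeasureTheory Finset Module

/-! ## §1 (21) and the `σ₀` bookkeeping of p. 260 -/

section Sigma

variable {ι : Type*} [Fintype ι]

/-- **(21)**: a finite product of positive factors is the exponential of the sum of their logarithms —
`(σ/σ₀)(A − D̃(A)) = Π_{b∈Ω₁} (σ/σ₀)(A(b) − D̃(A, c(b), b)) = exp[Σ_{b∈Ω₁} (log σ/σ₀)(A(b) − D̃(A, c(b), b))]`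
(`ρ b` = the factor of the bond `b`; positivity from p. 260 *"σ(A) is an analytic, positive, even function of A in a
neighbourhood of 0∈𝔤"*). [cite: Balaban1985UV3, (21) p.261] -/
theorem eq21 (ρ : ι → ℝ) (hρ : ∀ b, 0 < ρ b) : ∏ b, ρ b = Real.exp (∑ b, Real.log (ρ b)) := by
  rw [Real.exp_sum]
  exact prod_congr rfl (fun b _ => (Real.exp_log (hρ b)).symm)

/-- (21) in the composed form of print: with `σ` the Haar density, `σ₀ = σ(0)`, and bond arguments
`B(b) = A(b) − D̃(A, c(b), b)`, `Π_b (σ/σ₀)(B(b)) = exp[Σ_b log((σ/σ₀)(B(b)))]`. [cite: Balaban1985UV3, (21) p.261] -/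
theorem eq21_sigma {V : Type*} (σ : V → ℝ) (σ₀ : ℝ) (B : ι → V) (hσ : ∀ b, 0 < σ (B b) / σ₀) :
    ∏ b, σ (B b) / σ₀ = Real.exp (∑ b, Real.log (σ (B b) / σ₀)) :=
  eq21 (fun b => σ (B b) / σ₀) hσ

/-- p. 260, *"dU′ = σ(A′)dA′ = σ₀ σ/σ₀ (A′)dA′, σ₀ = σ(0)"* taken over the bonds: the product of the Haar densities
splits as `Π_b σ(A′_b) = σ₀^{#bonds} · Π_b (σ/σ₀)(A′_b)` (`σ₀ ≠ 0`). [cite: Balaban1985UV3, p.260 (before (18))] -/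
theorem haar_density_split {V : Type*} (σ : V → ℝ) {σ₀ : ℝ} (hσ₀ : σ₀ ≠ 0) (A : ι → V) :
    ∏ b, σ (A b) = σ₀ ^ Fintype.card ι * ∏ b, (σ (A b) / σ₀) := by
  have : (σ₀ ^ Fintype.card ι : ℝ) = ∏ _b : ι, σ₀ := by rw [prod_const, card_univ]
  rw [this, ← prod_mul_distrib]
  exact prod_congr rfl (fun b _ => by field_simp)

/-- The `σ₀` BOOKKEEPING behind `log σ₀|Ω₁*|` in (18): `σ₀` per bond of Ω₁ (from `dU′ = σ₀(σ/σ₀)dA′`), `σ₀⁻¹` per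
coarse bond of Ω₁^{(1)} (from (16)) and `σ₀⁻¹` per axial-gauge δ-function, i.e.
`σ₀^{nB}·(σ₀⁻¹)^{nC}·(σ₀⁻¹)^{nA} = exp[log σ₀ · (nB − nC − nA)] = exp[log σ₀·|Ω₁*|]` (`σ₀ > 0`; the count
`|Ω₁*| = nB − nC − nA` is p. 260's definition, formalised in `…B10StarCount`). [cite: Balaban1985UV3, (18) p.260] -/
theorem sigma0_pow_bookkeeping {σ₀ : ℝ} (hσ₀ : 0 < σ₀) (nB nC nA : ℕ) :
    σ₀ ^ nB * (σ₀⁻¹) ^ nC * (σ₀⁻¹) ^ nA = Real.exp (Real.log σ₀ * ((nB : ℝ) - nC - nA)) := by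
  rw [show Real.log σ₀ * ((nB : ℝ) - nC - nA) = (nB : ℝ) * Real.log σ₀ - (nC : ℝ) * Real.log σ₀ - (nA : ℝ) * Real.log σ₀
    by ring]
  rw [Real.exp_sub, Real.exp_sub, Real.exp_nat_mul, Real.exp_nat_mul, Real.exp_nat_mul, Real.exp_log hσ₀]
  rw [inv_pow, inv_pow, div_eq_mul_inv, div_eq_mul_inv]

end Sigma

/-! ## §2 The transformation `A → g₀A`: the Jacobian on the space of independent variables -/

section Jacobian

variable {S : Type*} [NormedAddCommGroup S] [NormedSpace ℝ S] [MeasurableSpace S] [BorelSpace S]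
  [FiniteDimensional ℝ S] (μ : Measure S) [μ.IsAddHaarMeasure]
  {F : Type*} [NormedAddCommGroup F] [NormedSpace ℝ F]

/-- **The transformation `A → g₀A` in (18)** (p. 261): on the finite-dimensional real space `S` of independent
integration variables (p. 271: *"we write the integral in terms of the independent variables Ã … A = CÃ"*) with its
Lebesgue (additive Haar) measure, `∫ W(A′) dA′ = g₀^{dim S} ∫ W(g₀A) dA = exp[dim S · log g₀] ∫ W(g₀A) dA` for
`g₀ > 0` — the origin of the term `d(𝔤)log g₀|Ω₁*|` of (22) (`dim S = d(𝔤)|Ω₁*|`, §3). [cite: Balaban1985UV3, (22) p.261] -/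
theorem integral_rescale (W : S → F) {g₀ : ℝ} (hg : 0 < g₀) :
    ∫ A', W A' ∂μ = Real.exp ((finrank ℝ S : ℝ) * Real.log g₀) • ∫ A, W (g₀ • A) ∂μ := by
  have h := Measure.integral_comp_smul μ W g₀
  have hpow : (0 : ℝ) < g₀ ^ finrank ℝ S := pow_pos hg _
  rw [abs_of_pos (inv_pos.2 hpow)] at h
  rw [h, smul_smul, Real.exp_nat_mul, Real.exp_log hg, mul_inv_cancel₀ hpow.ne', one_smul]

/-- The same with the Jacobian written as the power `g₀^{dim S}`. [cite: Balaban1985UV3, (22) p.261] -/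
theorem integral_rescale_pow (W : S → F) {g₀ : ℝ} (hg : 0 < g₀) :
    ∫ A', W A' ∂μ = (g₀ ^ finrank ℝ S) • ∫ A, W (g₀ • A) ∂μ := by
  rw [integral_rescale μ W hg, Real.exp_nat_mul, Real.exp_log hg]

end Jacobian

/-! ## §3 The dimension of the constrained fluctuation space: `dim S = d(𝔤)·|Ω₁*|` by rank–nullity -/

section Dimension

variable {β γ : Type*} [Fintype β] [Fintype γ]
  {V : Type*} [AddCommGroup V] [Module ℝ V] [FiniteDimensional ℝ V]

/-- `dim (β → 𝔤) = #β · d(𝔤)`. [cite: Balaban1985UV3, (22) p.261] -/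
theorem finrank_bondSpace : finrank ℝ (β → V) = Fintype.card β * finrank ℝ V := by
  rw [Module.finrank_pi_fintype ℝ, sum_const, card_univ, smul_eq_mul]

/-- **Rank–nullity for the δ-constraints.**  If the `𝔤`-valued linear constraints `C` (one per coarse bond of
Ω₁^{(1)} — the `δ((QA)(c))` of (18) — and one per axial-gauge condition — the `δ_{Ax}(A)` of (18), (9)) on the
`𝔤`-valued bond variables of Ω₁ are INDEPENDENT (surjective), the space of independent variables `ker C` (p. 271) has
dimension `d(𝔤)·(#bonds − #constraints)`. [cite: Balaban1985UV3, (18) p.260, (22) p.261] -/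
theorem finrank_ker_constraints (C : (β → V) →ₗ[ℝ] (γ → V)) (hC : Function.Surjective C) :
    (finrank ℝ (LinearMap.ker C) : ℤ) = (finrank ℝ V : ℤ) * ((Fintype.card β : ℤ) - Fintype.card γ) := by
  have h := LinearMap.finrank_range_add_finrank_ker C
  rw [LinearMap.range_eq_top.2 hC, finrank_top, finrank_bondSpace, finrank_bondSpace] at h
  have h' : ((Fintype.card γ * finrank ℝ V : ℕ) : ℤ) + (finrank ℝ (LinearMap.ker C) : ℤ)
      = ((Fintype.card β * finrank ℝ V : ℕ) : ℤ) := by exact_mod_cast h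
  push_cast at h'
  linarith

/-- With `#constraints = #coarse bonds + #axial conditions` (`γ = γC ⊕ γA`): **`dim ker C = d(𝔤)·|Ω₁*|`**, where
`|Ω₁*| = #bonds − #coarse bonds − #axial conditions` is the printed count of p. 260 (the integer `nstar`; on the
lattice carrier of record it is `…B10StarCount.starCount`). [cite: Balaban1985UV3, (18) p.260, (22) p.261] -/
theorem finrank_ker_eq_dg_mul_star {γC γA : Type*} [Fintype γC] [Fintype γA]
    (C : (β → V) →ₗ[ℝ] (γC ⊕ γA → V)) (hC : Function.Surjective C) {nstar : ℤ}
    (hstar : nstar = (Fintype.card β : ℤ) - Fintype.card γC - Fintype.card γA) :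
    (finrank ℝ (LinearMap.ker C) : ℤ) = (finrank ℝ V : ℤ) * nstar := by
  rw [finrank_ker_constraints C hC, Fintype.card_sum, hstar]
  push_cast
  ring

end Dimension

/-! ## §4 The exponent and the cut-off under `A → g₀A` -/

section Exponent

variable {S : Type*} [AddCommGroup S] [Module ℝ S]

/-- **(v)**: `−(1/g₀²)` times the second line of (19) at the rescaled field `g₀A` is the exponent of the first member
of (22): `−(1/g₀²)[A(U₁) − ⟨D̃^{(2)}(g₀A), J⟩ + ½⟨g₀A, Δ(U₁)g₀A⟩ + Ṽ₀(g₀A)] = −(1/g₀²)A(U₁) + ⟨D̃^{(2)}(A), J⟩ −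
½⟨A, Δ(U₁)A⟩ − (1/g₀²)Ṽ₀(g₀A)` — because `A ↦ ⟨D̃^{(2)}(A), J⟩` is homogeneous of degree two (p. 260: `D̃^{(2)}` =
the second-order terms of `D̃`) and `⟨·, Δ(U₁)·⟩` is bilinear (`AU1` = `A(U₁)`, `l2 A` = `⟨D̃^{(2)}(A), J⟩`, `Δ` the
bilinear form, `Vt` = `Ṽ₀`; `g₀ ≠ 0`). [cite: Balaban1985UV3, (19) p.261, (22) p.261] -/
theorem exponent_rescale (AU1 : ℝ) (l2 : S → ℝ) (h2 : ∀ (c : ℝ) (A : S), l2 (c • A) = c ^ 2 * l2 A)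
    (Δ : S →ₗ[ℝ] S →ₗ[ℝ] ℝ) (Vt : S → ℝ) {g₀ : ℝ} (hg : g₀ ≠ 0) (A : S) :
    -(1 / g₀ ^ 2) * (AU1 - l2 (g₀ • A) + (1 / 2) * Δ (g₀ • A) (g₀ • A) + Vt (g₀ • A))
      = -(1 / g₀ ^ 2) * AU1 + l2 A - (1 / 2) * Δ A A - (1 / g₀ ^ 2) * Vt (g₀ • A) := by
  rw [h2, map_smul, map_smul, LinearMap.smul_apply, smul_eq_mul, smul_eq_mul]
  field_simp
  ring

/-- **(vi)**: the small-field cut-off rescales — `χ({|g₀A(b)| < g₀p²(g₀)}) = χ({|A(b)| < p²(g₀)})`, i.e.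
`‖g₀ • a‖ < g₀·t ↔ ‖a‖ < t` for `g₀ > 0` ((18) *"χ = Π_{b∈Ω₁} χ({|A(b)| < g₀p²(g₀)})"* vs (22) *"χ = Π_{b∈Ω₁}
χ({|A(b)| < p²(g₀)})"*). [cite: Balaban1985UV3, (18) p.260, (22) p.261] -/
theorem cutoff_rescale {V : Type*} [NormedAddCommGroup V] [NormedSpace ℝ V] {g₀ : ℝ} (hg : 0 < g₀) (t : ℝ) (a : V) :
    ‖g₀ • a‖ < g₀ * t ↔ ‖a‖ < t := by
  rw [norm_smul, Real.norm_of_nonneg hg.le]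
  exact mul_lt_mul_iff_of_pos_left hg

/-- The product cut-off over the bonds rescales factor by factor (`π b` = the bond coordinate `A ↦ A(b)`, linear).
[cite: Balaban1985UV3, (18) p.260, (22) p.261] -/
theorem cutoff_prod_rescale {ι : Type*} [Fintype ι] {V : Type*} [NormedAddCommGroup V] [NormedSpace ℝ V]
    (π : ι → S →ₗ[ℝ] V) {g₀ : ℝ} (hg : 0 < g₀) (t : ℝ) (A : S) :
    (∏ b, (if ‖π b (g₀ • A)‖ < g₀ * t then (1 : ℝ) else 0)) = ∏ b, (if ‖π b A‖ < t then (1 : ℝ) else 0) := by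
  refine prod_congr rfl (fun b _ => ?_)
  rw [map_smul]
  simp only [cutoff_rescale hg]

end Exponent

/-! ## §5 The first member of (22) from (18)–(21) -/

section Assembly

variable {S : Type*} [NormedAddCommGroup S] [NormedSpace ℝ S] [MeasurableSpace S] [BorelSpace S]
  [FiniteDimensional ℝ S] (μ : Measure S) [μ.IsAddHaarMeasure]
  {ι : Type*} [Fintype ι] {V : Type*} [NormedAddCommGroup V] [NormedSpace ℝ V]

/-- The `A′`-integrand of (18) with (19)–(21) inserted (determinant and `σ/σ₀` exponentiated into `𝓋`, (20)–(21); the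
action expanded by the second line of (19)): `χ′(A′)·exp[𝓋(A′) − (1/g₀²)(A(U₁) − ⟨D̃^{(2)}(A′), J⟩ + ½⟨A′, Δ(U₁)A′⟩ +
Ṽ₀(A′)) − E + log σ₀|Ω₁*|]` with `χ′ = Π_b χ({|A′(b)| < g₀p²(g₀)})`.  A bookkeeping abbreviation (real-valued), not a
statement. [cite: Balaban1985UV3, (18) p.260, (19)–(21) p.261] -/
def integrand18 (π : ι → S →ₗ[ℝ] V) (v : S → ℝ) (AU1 : ℝ) (l2 : S → ℝ) (Δ : S →ₗ[ℝ] S →ₗ[ℝ] ℝ) (Vt : S → ℝ)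
    (E logσ₀ nstar g₀ p2 : ℝ) (A' : S) : ℝ :=
  (∏ b, (if ‖π b A'‖ < g₀ * p2 then (1 : ℝ) else 0)) *
    Real.exp (v A' - (1 / g₀ ^ 2) * (AU1 - l2 A' + (1 / 2) * Δ A' A' + Vt A') - E + logσ₀ * nstar)

/-- The `A`-integrand of the first member of (22): `χ(A)·exp[𝓋(g₀A) − (1/g₀²)A(U₁) + ⟨D̃^{(2)}(A), J⟩ − ½⟨A, Δ(U₁)A⟩ −
(1/g₀²)Ṽ₀(g₀A)]` with `χ = Π_b χ({|A(b)| < p²(g₀)})` (the constants `−E + log σ₀|Ω₁*| + d(𝔤)log g₀|Ω₁*|` kept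
outside).  A bookkeeping abbreviation, not a statement. [cite: Balaban1985UV3, (22) p.261] -/
def integrand22 (π : ι → S →ₗ[ℝ] V) (v : S → ℝ) (AU1 : ℝ) (l2 : S → ℝ) (Δ : S →ₗ[ℝ] S →ₗ[ℝ] ℝ) (Vt : S → ℝ)
    (g₀ p2 : ℝ) (A : S) : ℝ :=
  (∏ b, (if ‖π b A‖ < p2 then (1 : ℝ) else 0)) *
    Real.exp (v (g₀ • A) - (1 / g₀ ^ 2) * AU1 + l2 A - (1 / 2) * Δ A A - (1 / g₀ ^ 2) * Vt (g₀ • A))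

omit [MeasurableSpace S] [BorelSpace S] [FiniteDimensional ℝ S] in
/-- Pointwise: the integrand of (18) at `A′ = g₀A` is `exp[−E + log σ₀|Ω₁*|]` times the integrand of (22) at `A`
((v) and (vi)). [cite: Balaban1985UV3, (22) p.261] -/
theorem integrand18_smul (π : ι → S →ₗ[ℝ] V) (v : S → ℝ) (AU1 : ℝ) (l2 : S → ℝ)
    (h2 : ∀ (c : ℝ) (A : S), l2 (c • A) = c ^ 2 * l2 A) (Δ : S →ₗ[ℝ] S →ₗ[ℝ] ℝ) (Vt : S → ℝ)
    (E logσ₀ nstar : ℝ) {g₀ : ℝ} (hg : 0 < g₀) (p2 : ℝ) (A : S) :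
    integrand18 π v AU1 l2 Δ Vt E logσ₀ nstar g₀ p2 (g₀ • A)
      = Real.exp (-E + logσ₀ * nstar) * integrand22 π v AU1 l2 Δ Vt g₀ p2 A := by
  unfold integrand18 integrand22
  rw [cutoff_prod_rescale π hg p2 A]
  have hexp : v (g₀ • A) - (1 / g₀ ^ 2) * (AU1 - l2 (g₀ • A) + (1 / 2) * Δ (g₀ • A) (g₀ • A) + Vt (g₀ • A))
        - E + logσ₀ * nstar
      = (-E + logσ₀ * nstar) + (v (g₀ • A) - (1 / g₀ ^ 2) * AU1 + l2 A - (1 / 2) * Δ A A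
          - (1 / g₀ ^ 2) * Vt (g₀ • A)) := by
    have := exponent_rescale AU1 l2 h2 Δ Vt hg.ne' A
    linarith
  rw [hexp, Real.exp_add]
  ring

/-- **(18) + (19)–(21) + `A → g₀A` ⇒ the first member of (22).**  On the space `S` of independent variables with its
Lebesgue measure: `∫ dA′ [integrand of (18)] = exp[−E + log σ₀|Ω₁*| + dim S · log g₀] · ∫ dA [integrand of (22)]`
(`g₀ > 0`; hypotheses: `⟨D̃^{(2)}(·), J⟩` homogeneous of degree two).  With `dim S = d(𝔤)|Ω₁*|` (§3) the constant is the
printed `exp[−E + log σ₀|Ω₁*| + d(𝔤)log g₀|Ω₁*|]` (`eq22_first_member_constants`). [cite: Balaban1985UV3, (22) p.261] -/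
theorem eq22_first_member (π : ι → S →ₗ[ℝ] V) (v : S → ℝ) (AU1 : ℝ) (l2 : S → ℝ)
    (h2 : ∀ (c : ℝ) (A : S), l2 (c • A) = c ^ 2 * l2 A) (Δ : S →ₗ[ℝ] S →ₗ[ℝ] ℝ) (Vt : S → ℝ)
    (E logσ₀ nstar : ℝ) {g₀ : ℝ} (hg : 0 < g₀) (p2 : ℝ) :
    ∫ A', integrand18 π v AU1 l2 Δ Vt E logσ₀ nstar g₀ p2 A' ∂μ
      = Real.exp (-E + logσ₀ * nstar + (finrank ℝ S : ℝ) * Real.log g₀) *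
          ∫ A, integrand22 π v AU1 l2 Δ Vt g₀ p2 A ∂μ := by
  rw [integral_rescale μ _ hg, smul_eq_mul]
  simp_rw [integrand18_smul π v AU1 l2 h2 Δ Vt E logσ₀ nstar hg p2]
  rw [integral_const_mul, ← mul_assoc, ← Real.exp_add]
  congr 2
  ring

/-- The constant of (22)'s first member in the printed form: if the space of independent variables has
`dim S = d(𝔤)·|Ω₁*|` (§3: independent δ-constraints), then
`∫ dA′ [integrand of (18)] = exp[−E + log σ₀|Ω₁*| + d(𝔤)log g₀|Ω₁*|] · ∫ dA [integrand of (22)]` — verbatim the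
exponent *"− E + log σ₀|Ω₁*| + d(𝔤)log g₀|Ω₁*|"* of (22). [cite: Balaban1985UV3, (22) p.261] -/
theorem eq22_first_member_constants (π : ι → S →ₗ[ℝ] V) (v : S → ℝ) (AU1 : ℝ) (l2 : S → ℝ)
    (h2 : ∀ (c : ℝ) (A : S), l2 (c • A) = c ^ 2 * l2 A) (Δ : S →ₗ[ℝ] S →ₗ[ℝ] ℝ) (Vt : S → ℝ)
    (E logσ₀ : ℝ) {g₀ : ℝ} (hg : 0 < g₀) (p2 : ℝ) {dg : ℕ} {nstar : ℤ}
    (hdim : (finrank ℝ S : ℤ) = (dg : ℤ) * nstar) :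
    ∫ A', integrand18 π v AU1 l2 Δ Vt E logσ₀ nstar g₀ p2 A' ∂μ
      = Real.exp (-E + logσ₀ * nstar + (dg : ℝ) * Real.log g₀ * nstar) *
          ∫ A, integrand22 π v AU1 l2 Δ Vt g₀ p2 A ∂μ := by
  rw [eq22_first_member μ π v AU1 l2 h2 Δ Vt E logσ₀ nstar hg p2]
  have hdim' : (finrank ℝ S : ℝ) = (dg : ℝ) * (nstar : ℝ) := by exact_mod_cast hdim
  rw [hdim']
  congr 2
  ring

end Assembly

/-! ## §6 On the lattice carrier of record: `dim S = d(𝔤)·|B(Λ)*|` with `|B(Λ)*| = …B10StarCount.starCount Λ` -/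

section Lattice

open Literature.MathematicalPhysics.QuantumFieldTheory.Balaban1983to89
open Literature.MathematicalPhysics.QuantumFieldTheory.Balaban1983to89.B10StarCount

variable {P : Params} {j : ℕ}

/-- The axial gauge-fixing conditions of (9) as an index set: the pairs `(y, x)`, `y ∈ Λ`, `x ∈ B(y)∖{y}`
(one δ-function `δ_{Ax(y)}` component each). [cite: Balaban1985UV3, (9) p.258] -/
def axialPairs (Λ : Finset (Site P (j + 1))) : Finset (Σ _ : Site P (j + 1), Site P j) :=
  Λ.sigma (fun y => (block y).erase (emb y))

/-- Their number is `…B10StarCount.axialCount Λ` (`= (L^d − 1)|Λ|` by `axialCount_eq`). [cite: Balaban1985UV3, (9) p.258] -/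
theorem card_axialPairs (Λ : Finset (Site P (j + 1))) : (axialPairs Λ).card = axialCount Λ := by
  rw [axialPairs, Finset.card_sigma]
  rfl

/-- **`dim S = d(𝔤)·|B(Λ)*|` on `…Setup`.**  The fluctuation variables of (18)/(51) are the `𝔤`-valued fields on the
bonds belonging to `B(Λ)` (`Λ = Ω₁^{(1)}`, resp. `Λ_{k+1}`); the δ-functions `δ(QA)δ_{Ax}(A)` are `𝔤`-valued linear
constraints indexed by the coarse bonds of `Λ` and the axial pairs.  If they are independent (the constraint map `C` is
surjective), the space `ker C` of independent variables has dimension `d(𝔤)·starCount Λ`, `starCount` = the printed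
`|Ω₁*|` of p. 260 (`…B10StarCount`). [cite: Balaban1985UV3, (18) p.260, (22) p.261] -/
theorem finrank_ker_eq_dg_mul_starCount {V : Type*} [AddCommGroup V] [Module ℝ V] [FiniteDimensional ℝ V]
    (Λ : Finset (Site P (j + 1)))
    (C : ({b // b ∈ bondsIn (blockSet Λ)} → V) →ₗ[ℝ]
      (({c // c ∈ bondsIn Λ} ⊕ {q // q ∈ axialPairs Λ}) → V))
    (hC : Function.Surjective C) :
    (finrank ℝ (LinearMap.ker C) : ℤ) = (finrank ℝ V : ℤ) * starCount Λ := by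
  apply finrank_ker_eq_dg_mul_star C hC
  unfold starCount
  rw [Fintype.card_coe, Fintype.card_coe, Fintype.card_coe, card_axialPairs]

/-- **(22), first member, on the lattice carrier of record.**  With `S = ker C` the space of independent variables
(p. 271) with its Borel structure, any Lebesgue (additive Haar) measure on it, the bond coordinates `A ↦ A(b)`, and the
data of (19)–(21):
`∫ dA′ [integrand of (18)] = exp[−E + log σ₀|B(Λ)*| + d(𝔤)log g₀|B(Λ)*|] · ∫ dA [integrand of (22)]`, `d(𝔤) = dim V`,
`|B(Λ)*| = starCount Λ`. [cite: Balaban1985UV3, (22) p.261] -/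
theorem eq22_first_member_lattice {V : Type*} [NormedAddCommGroup V] [NormedSpace ℝ V] [FiniteDimensional ℝ V]
    (Λ : Finset (Site P (j + 1)))
    (C : ({b // b ∈ bondsIn (blockSet Λ)} → V) →ₗ[ℝ]
      (({c // c ∈ bondsIn Λ} ⊕ {q // q ∈ axialPairs Λ}) → V))
    (hC : Function.Surjective C)
    [MeasurableSpace (LinearMap.ker C)] [BorelSpace (LinearMap.ker C)]
    (μ : Measure (LinearMap.ker C)) [μ.IsAddHaarMeasure]
    (v : LinearMap.ker C → ℝ) (AU1 : ℝ) (l2 : LinearMap.ker C → ℝ)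
    (h2 : ∀ (c : ℝ) (A : LinearMap.ker C), l2 (c • A) = c ^ 2 * l2 A)
    (Δ : LinearMap.ker C →ₗ[ℝ] LinearMap.ker C →ₗ[ℝ] ℝ) (Vt : LinearMap.ker C → ℝ)
    (E logσ₀ : ℝ) {g₀ : ℝ} (hg : 0 < g₀) (p2 : ℝ) :
    ∫ A', integrand18 (fun b => (LinearMap.proj b).comp (LinearMap.ker C).subtype) v AU1 l2 Δ Vt E logσ₀
        (starCount Λ) g₀ p2 A' ∂μ
      = Real.exp (-E + logσ₀ * (starCount Λ) + (finrank ℝ V : ℝ) * Real.log g₀ * (starCount Λ)) *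
          ∫ A, integrand22 (fun b => (LinearMap.proj b).comp (LinearMap.ker C).subtype) v AU1 l2 Δ Vt g₀ p2 A ∂μ :=
  eq22_first_member_constants μ _ v AU1 l2 h2 Δ Vt E logσ₀ hg p2
    (finrank_ker_eq_dg_mul_starCount Λ C hC)

end Lattice

/-! ## §7 The printed example `G = SU(2)`: positivity of `σ` near `0`, `σ₀ = 1/(2π²)` -/

section SU2

/-- p. 260: *"For example for SU(2) we have σ(A) = 1/2π² (sin|A|/|A|)², where |A| = Σ_{a=1}^{3} (Aᵃ)² ⟦sic: |A|²⟧, and an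
element A of the Lie algebra is represented as A = Σ_{a=1}^{3} σ_aAᵃ, σ_a are the three Pauli matrices"* — the density as
a function of `r = |A| ≥ 0`, with the removable singularity filled by its limit `1` at `r = 0`.  (Only the formula is
transcribed; that it IS the Haar density of SU(2) in exponential coordinates is not asserted here.)
[cite: Balaban1985UV3, p.260 (before (18))] -/
def sigmaSU2 (r : ℝ) : ℝ := 1 / (2 * Real.pi ^ 2) * (if r = 0 then 1 else Real.sin r / r) ^ 2

/-- `σ₀ = σ(0) = 1/(2π²)` for the printed SU(2) density. [cite: Balaban1985UV3, p.260 (before (18))] -/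
theorem sigmaSU2_zero : sigmaSU2 0 = 1 / (2 * Real.pi ^ 2) := by
  simp [sigmaSU2]

/-- p. 260 *"σ(A) is an analytic, positive, even function of A in a neighbourhood of 0∈𝔤"* — positivity, for the printed
SU(2) example, on the ball `|A| < π` (where `sin|A| > 0`). [cite: Balaban1985UV3, p.260 (before (18))] -/
theorem sigmaSU2_pos {r : ℝ} (h0 : 0 ≤ r) (hπ : r < Real.pi) : 0 < sigmaSU2 r := by
  unfold sigmaSU2
  have hc : (0 : ℝ) < 1 / (2 * Real.pi ^ 2) := by positivity
  apply mul_pos hc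
  apply pow_pos
  split_ifs with h
  · exact one_pos
  · have hr : 0 < r := lt_of_le_of_ne h0 (Ne.symm h)
    exact div_pos (Real.sin_pos_of_pos_of_lt_pi hr hπ) hr

/-- Hence the factors `(σ/σ₀)` of (18)/(21) are positive on `|A(b) − D̃(A, c(b), b)| < π` — the hypothesis `hρ` of
`eq21` for the printed example. [cite: Balaban1985UV3, (21) p.261] -/
theorem sigmaSU2_ratio_pos {r : ℝ} (h0 : 0 ≤ r) (hπ : r < Real.pi) : 0 < sigmaSU2 r / sigmaSU2 0 :=
  div_pos (sigmaSU2_pos h0 hπ) (by rw [sigmaSU2_zero]; positivity)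

end SU2


/-! ## §8  (v1.1) The printed normalisation `σ₀ = 1/2π²`: `σ_{SU(2)}` integrates to `1` over the ball `|A| < π` -/

section Mass

open _root_.MeasureTheory _root_.Metric _root_.Set

/-- The unit ball of `ℝ³` has volume `4π/3` (Mathlib `EuclideanSpace.volume_ball_fin_three`), as a real number. [folklore] -/
private theorem volume_real_unitBall_three :
    (volume : Measure (EuclideanSpace ℝ (Fin 3))).real (ball 0 1) = 4 * Real.pi / 3 := by
  rw [measureReal_def, EuclideanSpace.volume_ball_fin_three]
  rw [ENNReal.toReal_mul, ← ENNReal.ofReal_pow zero_le_one, one_pow, ENNReal.toReal_ofReal zero_le_one,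
    ENNReal.toReal_ofReal (by positivity)]
  ring

/-- `∫₀^π sin² = π/2`. [folklore] -/
private theorem integral_sin_sq_zero_pi : ∫ y in (0 : ℝ)..Real.pi, Real.sin y ^ 2 = Real.pi / 2 := by
  rw [integral_sin_sq]
  simp

/-- On `y > 0` the radial integrand `y² σ_{SU(2)}(y) 1_{y<π}` is `1_{y<π} · (1/2π²) sin² y`. [folklore] -/
private theorem radial_integrand_eq {y : ℝ} (hy : 0 < y) :
    y ^ 2 * (Iio Real.pi).indicator sigmaSU2 y =
      (Iio Real.pi).indicator (fun t => 1 / (2 * Real.pi ^ 2) * Real.sin t ^ 2) y := by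
  by_cases h : y < Real.pi
  · rw [indicator_of_mem (show y ∈ Iio Real.pi from h), indicator_of_mem (show y ∈ Iio Real.pi from h), sigmaSU2,
      if_neg hy.ne']
    field_simp
  · rw [indicator_of_notMem (show y ∉ Iio Real.pi from h), indicator_of_notMem (show y ∉ Iio Real.pi from h), mul_zero]

/-- The radial integral `∫_{y>0} y² σ_{SU(2)}(y) 1_{y<π} dy = (1/2π²)·(π/2) = 1/(4π)`. [cite: Balaban1985UV3, p. 260] -/
theorem radial_integral_sigmaSU2 :
    ∫ y in Ioi (0 : ℝ), y ^ 2 * (Iio Real.pi).indicator sigmaSU2 y = 1 / (4 * Real.pi) := by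
  rw [setIntegral_congr_fun measurableSet_Ioi (fun y hy => radial_integrand_eq hy)]
  rw [setIntegral_indicator measurableSet_Iio, show Ioi (0 : ℝ) ∩ Iio Real.pi = Ioo 0 Real.pi from rfl]
  rw [← integral_Ioc_eq_integral_Ioo, ← intervalIntegral.integral_of_le Real.pi_pos.le,
    intervalIntegral.integral_const_mul, integral_sin_sq_zero_pi]
  field_simp
  ring

/-- **THE PRINTED NORMALISATION `σ₀ = 1/2π²` (p. 260 «σ(A) = 1/2π² (sin|A|/|A|)²»): `∫_{|A|<π} σ_{SU(2)}(|A|) d³A = 1`**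
on `ℝ³` with the Euclidean norm `|A|² = Σ (A^a)²` — the density is a probability density on the injectivity ball of the
exponential chart of `SU(2)` (radial integration: `3 · (4π/3) · 1/(4π) = 1`). [cite: Balaban1985UV3, p. 260] -/
theorem integral_sigmaSU2_ball :
    ∫ A : EuclideanSpace ℝ (Fin 3),
        (ball (0 : EuclideanSpace ℝ (Fin 3)) Real.pi).indicator (fun A => sigmaSU2 ‖A‖) A = 1 := by
  have h1 : (fun A : EuclideanSpace ℝ (Fin 3) => (ball (0 : EuclideanSpace ℝ (Fin 3)) Real.pi).indicator
      (fun A => sigmaSU2 ‖A‖) A) = fun A => (Iio Real.pi).indicator sigmaSU2 ‖A‖ := by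
    funext A
    by_cases h : ‖A‖ < Real.pi
    · rw [indicator_of_mem (mem_ball_zero_iff.mpr h), indicator_of_mem (show ‖A‖ ∈ Iio Real.pi from h)]
    · rw [indicator_of_notMem (fun h' => h (mem_ball_zero_iff.mp h')),
        indicator_of_notMem (show ‖A‖ ∉ Iio Real.pi from h)]
  rw [h1, MeasureTheory.integral_fun_norm_addHaar volume ((Iio Real.pi).indicator sigmaSU2),
    finrank_euclideanSpace_fin, volume_real_unitBall_three]
  simp only [smul_eq_mul, nsmul_eq_mul]
  norm_num
  rw [radial_integral_sigmaSU2]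
  field_simp

end Mass

end Literature.MathematicalPhysics.QuantumFieldTheory.Balaban1983to89.B10Eq22Rescaling

end
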